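import Summits.CriticalPhenomena.PercolationContinuityZ3.Theorems.PercExchangeRateTransportModelFacts
import Summits.CriticalPhenomena.PercolationContinuityZ3.Theorems.PercExchangeRateTransportCriticalCurveRegular

/-!
# One-sided transport for the crux `SubcritExchangeUniformity` (K⁻, stmt-CriticalPhenomena-16062), line `onesided`:
# ONE-SIDED `closes` — if the critical jump `J(t) = θ(p_c t, t)` is NONINCREASING on compact sub-arcs of `(0,1)`,
# then `θ_{ℤ³}(p_c) = 0` (`PercolationContinuityZ3`)

Verbatim the route's deciding theorem `closes` (part (I) real-variable core + part (II) instantiation), with curve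
INVARIANCE weakened to curve MONOTONICITY: `J(p₃) ≤ J(lo) < J(p₃)/2`. `ModelFacts`, `CriticalCurveRegular` are tree
theorems. Helper stub `percolationContinuityZ3_of_curveMonotone` registered on stmt-CriticalPhenomena-16062 (lead c1).
-/

noncomputable section

namespace Summit.CriticalPhenomena.PercolationContinuityZ3.Theorems.SubcritExchangeUniformity.TransportMono

open MeasureTheory Filter Topology Set
open Literature.Probability.Percolation Literature.Probability.LatticeModels
open Summit.CriticalPhenomena.PercolationContinuityZ3.Theses.PercExchangeRateTransport
  (ModelFacts CriticalCurveRegular)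

-- The registered signature carries the items' full `let`-preamble, whose `Θ` (box one-arm polynomials) is not
-- referenced by the monotonicity hypothesis; it is reproduced verbatim, so the unused-variables linter is
-- silenced for this one declaration.
set_option linter.unusedVariables false in
/-- **One-sided `closes`.** `J nonincreasing on compact sub-arcs of (0,1)` implies `θ_{ℤ³}(p_c) = 0`. -/
theorem percolationContinuityZ3_of_curveMonotone : (let μ := labelMeasure (Site 3); let vert : Sym2 (Site 3) → Prop := fun e => ∃ x : Site 3, e = s(x, x + Pi.single (2 : Fin 3) 1); let cfg : ℝ → ℝ → (Sym2 (Site 3) → ℝ) → Set (Sym2 (Site 3)) := fun p t U => {e | e ∈ (zdGraph 3).edgeSet ∧ ((vert e ∧ U e ≤ t) ∨ (¬ vert e ∧ U e ≤ p))}; let Θ : ℕ → ℝ → ℝ → ℝ := fun n p t => μ.real {U | cfg p t U ∈ siteToBoundary 3 n}; let θ : ℝ → ℝ → ℝ := fun p t => μ.real {U | cfg p t U ∈ percolatesAt (0 : Site 3)}; let pc : ℝ → ℝ := fun t => sInf ({p : ℝ | 0 ≤ p ∧ p ≤ 1 ∧ 0 < θ p t} ∪ {1}); ∀ lo hi : ℝ,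 0 < lo → lo < hi → hi < 1 → ∀ s ∈ Set.Icc lo hi, ∀ t ∈ Set.Icc lo hi, s ≤ t → θ (pc t) t ≤ θ (pc s) s) → _root_.PercolationContinuityZ3 := by
  intro hJ
  /- (I) The real-variable core, percolation-free (verbatim the core of the route's `closes`, with
     curve invariance weakened to curve monotonicity): for a family `Θ n p t` of continuous
     functions, monotone in `p` and `t`, with `θ = ⨅ n Θ n`, threshold curve `pc`, slices
     `θ p p = th3 p`, `θ p 0 = th2 p`, continuity of `pc` on `(0,1)`, ANTITONICITY of
     `t ↦ θ (pc t) t` on compact sub-arcs, the phase structure of `th3`/`th2` around `p₃`/`p₂`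
     and the planar anchor `th2 p₂ = 0`, one gets `th3 p₃ = 0`.  Steps: (A) `t ≤ pc t` for
     `t < p₃`; (B) `pc t ≤ p₃` for `t > p₃`; (C) `pc p₃ = p₃` by continuity; (AV) `θ (pc t) t → 0`
     as `t ↓ 0` by upper semicontinuity at `(p₂, 0)`; then `J(p₃) ≤ J(lo) < J(p₃)/2`. -/
  have key : ∀ {Θ : ℕ → ℝ → ℝ → ℝ} {θ : ℝ → ℝ → ℝ} {pc : ℝ → ℝ}
      {th3 th2 : unitInterval → ℝ} {p₃ p₂ : ℝ} (hp₃ : p₃ ∈ unitInterval) (hp₂ : p₂ ∈ unitInterval),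
      (∀ p t, θ p t = ⨅ n, Θ n p t) →
      (∀ t, pc t = sInf ({p : ℝ | 0 ≤ p ∧ p ≤ 1 ∧ 0 < θ p t} ∪ {1})) →
      (∀ n, Continuous (fun x : ℝ × ℝ => Θ n x.1 x.2)) →
      (∀ n t, Monotone (fun p => Θ n p t)) →
      (∀ n p, Monotone (fun t => Θ n p t)) →
      (∀ n p t, 0 ≤ Θ n p t) →
      (∀ p : unitInterval, θ p p = th3 p) →
      (∀ p : unitInterval, θ p 0 = th2 p) →
      ContinuousOn pc (Set.Ioo 0 1) →
      (∀ lo hi : ℝ, 0 < lo → lo < hi → hi < 1 → ∀ s ∈ Set.Icc lo hi, ∀ t ∈ Set.Icc lo hi,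
        s ≤ t → θ (pc t) t ≤ θ (pc s) s) →
      0 < p₃ → p₃ < 1 → 0 < p₂ → p₂ < 1 →
      (∀ p : unitInterval, (p : ℝ) < p₃ → th3 p = 0) →
      (∀ p : unitInterval, p₃ < (p : ℝ) → 0 < th3 p) →
      (∀ p : unitInterval, p₂ < (p : ℝ) → 0 < th2 p) →
      th2 ⟨p₂, hp₂⟩ = 0 → th3 ⟨p₃, hp₃⟩ = 0 := by
    intro Θ θ pc th3 th2 p₃ p₂ hp₃ hp₂ hinf hpc hcont hmp hmt hnn hdiag hplane hpcc hJ h3l h3u h2l h2u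
      h3zero h3pos h2pos h2crit
    -- a small chooser of margins
    have hpick : ∀ a b c : ℝ, 0 < a → 0 < b → 0 < c →
        ∃ s, 0 < s ∧ s < a ∧ s < b ∧ s ≤ c / 2 := fun a b c ha hb hc => by
      refine ⟨min a (min b c) / 2, ?_, ?_, ?_, ?_⟩
      · have : 0 < min a (min b c) := lt_min ha (lt_min hb hc); linarith
      · have : min a (min b c) ≤ a := min_le_left _ _; linarith
      · have : min a (min b c) ≤ b := (min_le_right _ _).trans (min_le_left _ _); linarith
      · have : min a (min b c) ≤ c := (min_le_right _ _).trans (min_le_right _ _); linarith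
    -- basic facts about θ = inf_n Θ_n
    have hbdd : ∀ p t, BddBelow (Set.range fun n => Θ n p t) := fun p t =>
      ⟨0, by rintro _ ⟨n, rfl⟩; exact hnn n p t⟩
    have hθ_le : ∀ n p t, θ p t ≤ Θ n p t := fun n p t => by
      rw [hinf]; exact ciInf_le (hbdd p t) n
    have hθ_nn : ∀ p t, 0 ≤ θ p t := fun p t => by
      rw [hinf]; exact le_ciInf fun n => hnn n p t
    have hθ_mp : ∀ t p q, p ≤ q → θ p t ≤ θ q t := fun t p q hpq => by
      rw [hinf, hinf]; exact ciInf_mono (hbdd p t) fun n => hmp n t hpq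
    have hθ_mt : ∀ p s t, s ≤ t → θ p s ≤ θ p t := fun p s t hst => by
      rw [hinf, hinf]; exact ciInf_mono (hbdd p s) fun n => hmt n p hst
    -- the set whose infimum is pc t
    have hS_ne : ∀ t, ({p : ℝ | 0 ≤ p ∧ p ≤ 1 ∧ 0 < θ p t} ∪ {1}).Nonempty := fun t =>
      ⟨1, Or.inr rfl⟩
    have hS_bdd : ∀ t, BddBelow ({p : ℝ | 0 ≤ p ∧ p ≤ 1 ∧ 0 < θ p t} ∪ {1}) := fun t =>
      ⟨0, by
        rintro p (⟨hp, -⟩ | hp)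
        · exact hp
        · rw [Set.mem_singleton_iff] at hp; rw [hp]; exact zero_le_one⟩
    have hpc_le : ∀ t q, 0 ≤ q → q ≤ 1 → 0 < θ q t → pc t ≤ q := fun t q h0 h1 hpos => by
      rw [hpc]; exact csInf_le (hS_bdd t) (Or.inl ⟨h0, h1, hpos⟩)
    have hle_pc : ∀ t c, c ≤ 1 → (∀ p, 0 ≤ p → p < c → θ p t ≤ 0) → c ≤ pc t :=
        fun t c hc1 hzero => by
      rw [hpc]
      refine le_csInf (hS_ne t) ?_
      rintro p (⟨hp0, -, hpos⟩ | hp)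
      · by_contra hlt
        exact absurd (hzero p hp0 (not_le.mp hlt)) (not_le.mpr hpos)
      · rw [Set.mem_singleton_iff] at hp; rw [hp]; exact hc1
    -- (A) below the isotropic critical point the curve lies above the diagonal
    have hA : ∀ t, 0 < t → t < p₃ → t ≤ pc t := fun t ht0 ht3 => by
      have ht1 : t ≤ 1 := (ht3.trans h3u).le
      refine hle_pc t t ht1 fun p hp0 hpt => ?_
      have e : θ t t = th3 ⟨t, ht0.le, ht1⟩ := hdiag ⟨t, ht0.le, ht1⟩
      have hz : th3 ⟨t, ht0.le, ht1⟩ = 0 := h3zero ⟨t, ht0.le, ht1⟩ ht3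
      calc θ p t ≤ θ t t := hθ_mp t p t hpt.le
        _ = 0 := by rw [e, hz]
    -- (B) above it the curve lies below the level p₃
    have hB : ∀ t, p₃ < t → t < 1 → pc t ≤ p₃ := fun t ht3 ht1 => by
      by_contra hcon'
      have hcon := not_le.mp hcon'
      obtain ⟨q, hq3, hqpc, hqt⟩ : ∃ q, p₃ < q ∧ q < pc t ∧ q < t :=
        ⟨min ((p₃ + pc t) / 2) ((p₃ + t) / 2), lt_min (by linarith) (by linarith),
          (min_le_left _ _).trans_lt (by linarith), (min_le_right _ _).trans_lt (by linarith)⟩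
      have hq0 : 0 ≤ q := (h3l.trans hq3).le
      have hq1 : q ≤ 1 := (hqt.trans ht1).le
      have hpos : 0 < θ q t := by
        have e : θ q q = th3 ⟨q, hq0, hq1⟩ := hdiag ⟨q, hq0, hq1⟩
        have hp : 0 < th3 ⟨q, hq0, hq1⟩ := h3pos ⟨q, hq0, hq1⟩ hq3
        calc (0 : ℝ) < θ q q := by rw [e]; exact hp
          _ ≤ θ q t := hθ_mt q q t hqt.le
      exact absurd (hpc_le t q hq0 hq1 hpos) (not_le.mpr hqpc)
    -- (C) continuity of the curve at p₃ pins the isotropic point onto the curve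
    have hC : pc p₃ = p₃ := by
      have hcw : ContinuousWithinAt pc (Set.Ioo 0 1) p₃ := hpcc p₃ ⟨h3l, h3u⟩
      rw [Metric.continuousWithinAt_iff] at hcw
      apply le_antisymm
      · by_contra hcon'
        have hcon := not_le.mp hcon'
        obtain ⟨δ, hδ, hδ'⟩ := hcw ((pc p₃ - p₃) / 2) (by linarith)
        obtain ⟨s, hs0, hsδ, hs1, -⟩ := hpick δ (1 - p₃) 1 hδ (by linarith) one_pos
        have hmem : p₃ + s ∈ Set.Ioo (0 : ℝ) 1 := ⟨by linarith, by linarith⟩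
        have hdist : dist (p₃ + s) p₃ < δ := by
          rw [Real.dist_eq, show p₃ + s - p₃ = s by ring, abs_of_pos hs0]; exact hsδ
        have h := hδ' hmem hdist
        rw [Real.dist_eq] at h
        have hBt := hB (p₃ + s) (by linarith) (by linarith)
        have h' := (abs_sub_lt_iff.mp h).2
        linarith
      · by_contra hcon'
        have hcon := not_le.mp hcon'
        obtain ⟨δ, hδ, hδ'⟩ := hcw ((p₃ - pc p₃) / 2) (by linarith)
        obtain ⟨s, hs0, hsδ, hs3, hsε⟩ := hpick δ p₃ (p₃ - pc p₃) hδ h3l (by linarith)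
        have hmem : p₃ - s ∈ Set.Ioo (0 : ℝ) 1 := ⟨by linarith, by linarith⟩
        have hdist : dist (p₃ - s) p₃ < δ := by
          rw [Real.dist_eq, show p₃ - s - p₃ = -s by ring, abs_neg, abs_of_pos hs0]; exact hsδ
        have h := hδ' hmem hdist
        rw [Real.dist_eq] at h
        have hAt := hA (p₃ - s) (by linarith) (by linarith)
        have h' := (abs_sub_lt_iff.mp h).1
        linarith
    -- (AV) the planar anchor: J(t) → 0 as t ↓ 0, by upper semicontinuity at (p_c(ℤ²), 0)
    have hAV : ∀ ε, 0 < ε → ∃ t₁, 0 < t₁ ∧ ∀ t, 0 < t → t < t₁ → θ (pc t) t < ε := fun ε hε => by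
      have h0 : θ p₂ 0 = 0 := by
        have e : θ p₂ 0 = th2 ⟨p₂, hp₂⟩ := hplane ⟨p₂, hp₂⟩
        rw [e]; exact h2crit
      have hlt : (⨅ n, Θ n p₂ 0) < ε := by rw [← hinf, h0]; exact hε
      obtain ⟨n₀, hn₀⟩ := exists_lt_of_ciInf_lt hlt
      have hopen : IsOpen {x : ℝ × ℝ | Θ n₀ x.1 x.2 < ε} := isOpen_lt (hcont n₀) continuous_const
      obtain ⟨r, hr, hball⟩ := Metric.isOpen_iff.mp hopen (p₂, 0) hn₀
      obtain ⟨s, hs0, hsr, hs1, -⟩ := hpick r (1 - p₂) 1 hr (by linarith) one_pos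
      refine ⟨s, hs0, fun t ht0 hts => ?_⟩
      have hq0 : 0 ≤ p₂ + s := by linarith
      have hq1 : p₂ + s ≤ 1 := by linarith
      have hΘ : Θ n₀ (p₂ + s) t < ε := by
        have hmem : ((p₂ + s, t) : ℝ × ℝ) ∈ Metric.ball ((p₂, 0) : ℝ × ℝ) r := by
          rw [Metric.mem_ball, Prod.dist_eq, Real.dist_eq, Real.dist_eq,
            show p₂ + s - p₂ = s by ring, sub_zero, abs_of_pos hs0, abs_of_pos ht0]
          exact max_lt hsr (hts.trans hsr)
        exact hball hmem
      have hθq : 0 < θ (p₂ + s) t := by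
        have e : θ (p₂ + s) 0 = th2 ⟨p₂ + s, hq0, hq1⟩ := hplane ⟨p₂ + s, hq0, hq1⟩
        have hp : 0 < th2 ⟨p₂ + s, hq0, hq1⟩ :=
          h2pos ⟨p₂ + s, hq0, hq1⟩ (show p₂ < p₂ + s by linarith)
        calc (0 : ℝ) < θ (p₂ + s) 0 := by rw [e]; exact hp
          _ ≤ θ (p₂ + s) t := hθ_mt _ 0 t ht0.le
      calc θ (pc t) t ≤ θ (p₂ + s) t := hθ_mp t _ _ (hpc_le t _ hq0 hq1 hθq)
        _ ≤ Θ n₀ (p₂ + s) t := hθ_le n₀ _ t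
        _ < ε := hΘ
    -- assembly: J(p₃) = θ_{ℤ³}(p_c); if it were positive, push it down the curve to a small t
    -- (monotonicity: J(p₃) ≤ J(lo)) and contradict (AV)
    have hJ3 : θ (pc p₃) p₃ = th3 ⟨p₃, hp₃⟩ := by rw [hC]; exact hdiag ⟨p₃, hp₃⟩
    rw [← hJ3]
    refine le_antisymm (not_lt.mp fun hpos => ?_) (hθ_nn _ _)
    obtain ⟨t₁, ht₁, hsmall⟩ := hAV (θ (pc p₃) p₃ / 2) (half_pos hpos)
    obtain ⟨lo, hlo0, hlot, hlo3, -⟩ := hpick t₁ p₃ 1 ht₁ h3l one_pos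
    have hlohi : lo < (p₃ + 1) / 2 := by linarith
    have hhi : (p₃ + 1) / 2 < 1 := by linarith
    have e1 := hJ lo ((p₃ + 1) / 2) hlo0 hlohi hhi lo ⟨le_rfl, hlohi.le⟩ p₃ ⟨hlo3.le, by linarith⟩
      hlo3.le
    have e3 := hsmall lo hlo0 hlot
    linarith
  /- (II) Instantiation: the label-coupled anisotropic family on ℤ²×ℤ (Θ, θ, pc are read off the
     tree theorems `modelFacts_proof` / `CriticalCurveRegular_proof` and the hypothesis by
     unification), the tree theorems `0 < p_c(ℤ^d) < 1` (Grimmett 1999 Thm (1.10),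
     `Grimmett1999_criticalProb_pos_lt_one_holds`) and `θ_{ℤ²}(p_c) = 0` (Harris 1960 + Kesten 1980,
     `percolationContinuity_two kesten_criticalProb_Z2_holds harris_theta_half_holds`), `θ = 0`
     below / `θ > 0` above `p_c`; no crux enters. -/
  show Literature.Probability.Percolation.theta (Literature.Probability.LatticeModels.zdGraph 3) 0
      (Literature.Probability.Percolation.criticalProbI 3) = 0
  have hMF : ModelFacts :=
    Summit.CriticalPhenomena.PercolationContinuityZ3.Theorems.ModelFacts.modelFacts_proof
  have hCC : CriticalCurveRegular :=
    Summit.CriticalPhenomena.PercolationContinuityZ3.Cruxes.CriticalCurveRegular.Locmod.CriticalCurveRegular_proof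
  obtain ⟨h1, -, h3, h4, -, h6, h7, -, h9, h10⟩ := hMF
  obtain ⟨hcc1, -⟩ := hCC
  have h3b :=
    Literature.Probability.Percolation.Grimmett1999_criticalProb_pos_lt_one_holds 3 (by norm_num)
  have h2b :=
    Literature.Probability.Percolation.Grimmett1999_criticalProb_pos_lt_one_holds 2 (by norm_num)
  have hPA : Literature.Probability.Percolation.PercolationContinuity 2 :=
    Literature.Probability.Percolation.percolationContinuity_two
      Literature.Probability.Percolation.kesten_criticalProb_Z2_holds
      Literature.Probability.Percolation.harris_theta_half_holds
  exact key
    (th3 := Literature.Probability.Percolation.theta (Literature.Probability.LatticeModels.zdGraph 3) 0)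
    (th2 := Literature.Probability.Percolation.theta (Literature.Probability.LatticeModels.zdGraph 2) 0)
    (Literature.Probability.Percolation.criticalProb_mem_Icc
      (Literature.Probability.LatticeModels.zdGraph 3) 0)
    (Literature.Probability.Percolation.criticalProb_mem_Icc
      (Literature.Probability.LatticeModels.zdGraph 2) 0)
    h7 (fun _ => rfl) h1 h3 h4 (fun n p t => (h6 n p t).1) h9 h10 hcc1 hJ h3b.1 h3b.2 h2b.1 h2b.2
    (fun p hp => Literature.Probability.Percolation.theta_eq_zero_of_lt_criticalProb_holds _ _ p hp)
    (fun p hp => Literature.Probability.Percolation.theta_pos_of_criticalProb_lt_holds _ _ p hp)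
    (fun p hp => Literature.Probability.Percolation.theta_pos_of_criticalProb_lt_holds _ _ p hp)
    hPA

end Summit.CriticalPhenomena.PercolationContinuityZ3.Theorems.SubcritExchangeUniformity.TransportMono

end
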